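import Literature.NumberTheory.Sieve.LargestPrimeFactorCubicGoodCubesRel
import HarnessLib

/-!
# Heath-Brown 2001 (PLMS), §8: the upper Riemann sum `∑_{k good} m³/N⁺_k ≤ ∫_{box} dx/N(x) ≤ 2π log(N₂/N₁) log E/(6√3)`

Topic `Literature/NumberTheory/Sieve`; a PROVED measure-theoretic layer (one definition with body, no named
facts) under the named fact `Irving2015_largestPrimeFactor_cubic` (`LargestPrimeFactorCubic.lean`), the
upper-bound companion of `…CubeCover`/`…GoodCubesRel` (`genVolume_shrunk_le_rel`, a LOWER bound for the
cube sum).  Source: D. R. Heath-Brown, *The largest prime factor of `X³ + 2`*, Proc. London Math. Soc. (3)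
82 (2001) 554–596, §8 p. 33: "`∑_𝓑 I(𝓑) ≤ I(𝓡₀)`" and the evaluation `I₁ ≪ log² X`-type bounds ((8.13)),
used to control the error terms carried by the cubes (p. 30: the relative error `O(X^{−δ/6})` times
`∑_𝓑 m(𝓑)/N_𝓑`).  PROVED:

* `hCube m k` (the half-open cube `∏ (k_i m, (k_i+1)m]`), `volume_hCube`, `disjoint_hCube`,
  `integrable_genIntegrand`, `volume_im_zero` (the plane `Im β′ = 0` is null), `inBox_subset_genRegion_union`;
* **`sum_good_cubes_le_genVolume`** — `∑_{k ∈ goodSet} m³/N⁺_k ≤ genVolume 2 (2E) (−π) π N₁ N₂`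
  (`= 2π log(N₂/N₁) log E/(6√3)` by `genVolume_eq`).

## References

* D. R. Heath-Brown, *The largest prime factor of `X³ + 2`*, Proc. London Math. Soc. (3) 82 (2001)
  554–596, §8 pp. 30, 33–34. [`HeathBrown2001LargestPrimeFactorCubic`]

## Mathlib / tree search

Tree: `goodSet`, `GoodIdx`, `gridCube`, `corner`, `NplusRel`, `inv_normForm_le_rel` (`…CubeCover`/`…GoodCubesRel`),
`genRegion`, `genIntegrand`, `genVolume`, `genIntegrand_eq_genG`, `integrable_genG`, `genIntegrand_nonneg`
(`…VolumeGeneral`), `CubicSieve.embTEquiv`, `embTEquiv_apply`, `map_embT_volume`, `cplxEmb`, `cplxEmb_im`,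
`continuous_normForm`, `rho_pos` (`HeathBrownCubic…`).  Mathlib: `MeasureTheory.integral_biUnion_finset`,
`setIntegral_const`, `setIntegral_mono_on`, `integral_mono_ae`, `Measure.addHaar_submodule`,
`Complex.arg_eq_pi_iff`, `Complex.neg_pi_lt_arg`, `Complex.arg_le_pi`, `Real.volume_Ioc`, `Measure.prod_prod`.
-/

noncomputable section

open Finset Real MeasureTheory Set

namespace Literature.NumberTheory.Sieve.HeathBrown2001

open CubicSieve

/-! ### Half-open cubes -/

/-- The half-open grid cube `∏_i (k_i m, (k_i+1) m]`. [folklore] -/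
def hCube (m : ℝ) (k : ℕ × ℕ × ℕ) : Set (ℝ × ℝ × ℝ) :=
  Set.Ioc ((k.1 : ℝ) * m) (((k.1 : ℝ) + 1) * m) ×ˢ
    (Set.Ioc ((k.2.1 : ℝ) * m) (((k.2.1 : ℝ) + 1) * m) ×ˢ Set.Ioc ((k.2.2 : ℝ) * m) (((k.2.2 : ℝ) + 1) * m))

/-- `hCube ⊆ gridCube`. [folklore] -/
theorem hCube_subset_gridCube (m : ℝ) (k : ℕ × ℕ × ℕ) : hCube m k ⊆ gridCube m k :=
  Set.prod_mono Set.Ioc_subset_Icc_self (Set.prod_mono Set.Ioc_subset_Icc_self Set.Ioc_subset_Icc_self)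

/-- Auxiliary fact `measurableSet_hCube` for this file's estimates. [folklore] -/
theorem measurableSet_hCube (m : ℝ) (k : ℕ × ℕ × ℕ) : MeasurableSet (hCube m k) :=
  measurableSet_Ioc.prod (measurableSet_Ioc.prod measurableSet_Ioc)

/-- `vol(hCube) = m³` (`m ≥ 0`). [folklore] -/
theorem volume_hCube {m : ℝ} (hm : 0 ≤ m) (k : ℕ × ℕ × ℕ) : volume (hCube m k) = ENNReal.ofReal (m ^ 3) := by
  rw [hCube, Measure.volume_eq_prod, Measure.prod_prod, Measure.volume_eq_prod, Measure.prod_prod,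
    Real.volume_Ioc, Real.volume_Ioc, Real.volume_Ioc]
  have e : ∀ t : ℝ, (t + 1) * m - t * m = m := fun t => by ring
  rw [e, e, e, ← ENNReal.ofReal_mul hm, ← ENNReal.ofReal_mul (by positivity)]
  congr 1; ring

/-- Distinct indices give disjoint half-open cubes (`m > 0`). [folklore] -/
theorem disjoint_hCube {m : ℝ} (hm : 0 < m) {k k' : ℕ × ℕ × ℕ} (hkk : k ≠ k') : Disjoint (hCube m k) (hCube m k') := by
  -- one-dimensional disjointness for distinct integer indices
  have h1 : ∀ {a b : ℕ}, a ≠ b → Disjoint (Set.Ioc ((a : ℝ) * m) (((a : ℝ) + 1) * m)) (Set.Ioc ((b : ℝ) * m) (((b : ℝ) + 1) * m)) := by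
    intro a b hab
    rw [Set.disjoint_left]
    rintro t ⟨ha1, ha2⟩ ⟨hb1, hb2⟩
    rcases lt_or_gt_of_ne hab with h | h
    · have : (a : ℝ) + 1 ≤ b := by exact_mod_cast h
      nlinarith
    · have : (b : ℝ) + 1 ≤ a := by exact_mod_cast h
      nlinarith
  rw [hCube, hCube]
  by_cases h₁ : k.1 = k'.1
  · by_cases h₂ : k.2.1 = k'.2.1
    · have h₃ : k.2.2 ≠ k'.2.2 := fun h => hkk (Prod.ext h₁ (Prod.ext h₂ h))
      exact Set.disjoint_prod.mpr (Or.inr (Set.disjoint_prod.mpr (Or.inr (h1 h₃))))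
    · exact Set.disjoint_prod.mpr (Or.inr (Set.disjoint_prod.mpr (Or.inl (h1 h₂))))
  · exact Set.disjoint_prod.mpr (Or.inl (h1 h₁))

/-! ### Integrability and the null plane `Im β′ = 0` -/

/-- `genIntegrand` is integrable (`0 < N₁`, `0 < ν₁ ≤ ν₂`). [folklore] -/
theorem integrable_genIntegrand {ν₁ ν₂ φ₁ φ₂ N₁ N₂ : ℝ} (hN₁ : 0 < N₁) (hν₁ : 0 < ν₁) (hν : ν₁ ≤ ν₂) :
    Integrable (genIntegrand ν₁ ν₂ φ₁ φ₂ N₁ N₂) := by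
  have h1 : genIntegrand ν₁ ν₂ φ₁ φ₂ N₁ N₂ = fun x => genG ν₁ ν₂ φ₁ φ₂ N₁ N₂ (embT x) :=
    funext (genIntegrand_eq_genG N₁ N₂)
  rw [h1]
  let e : (ℝ × ℝ × ℝ) ≃ᵐ (ℝ × ℝ × ℝ) := embTEquiv.toHomeomorph.toMeasurableEquiv
  have hecoe : (⇑e : (ℝ × ℝ × ℝ) → ℝ × ℝ × ℝ) = ⇑embT := by
    funext x; exact embTEquiv_apply x
  have he : (fun x => genG ν₁ ν₂ φ₁ φ₂ N₁ N₂ (embT x)) = (genG ν₁ ν₂ φ₁ φ₂ N₁ N₂) ∘ e := by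
    funext x; simp [Function.comp_apply, hecoe]
  rw [he, ← integrable_map_equiv, hecoe, map_embT_volume]
  exact (integrable_genG hN₁ hν₁ hν).smul_measure ENNReal.ofReal_ne_top

/-- The plane `{Im β′(x) = 0} = {ρx₂ = ρ²x₃}` is Lebesgue-null. [folklore] -/
theorem volume_im_zero : volume {x : ℝ × ℝ × ℝ | (cplxEmb x).im = 0} = 0 := by
  -- it is the kernel of the non-zero linear functional `x ↦ ρ x₂ − ρ² x₃`
  let φ : (ℝ × ℝ × ℝ) →ₗ[ℝ] ℝ :=
    rho • ((LinearMap.fst ℝ ℝ ℝ).comp (LinearMap.snd ℝ ℝ (ℝ × ℝ))) -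
      (rho ^ 2) • ((LinearMap.snd ℝ ℝ ℝ).comp (LinearMap.snd ℝ ℝ (ℝ × ℝ)))
  have hφ : ∀ x : ℝ × ℝ × ℝ, φ x = rho * x.2.1 - rho ^ 2 * x.2.2 := fun x => by
    simp [φ]
  have hset : {x : ℝ × ℝ × ℝ | (cplxEmb x).im = 0} = (LinearMap.ker φ : Set (ℝ × ℝ × ℝ)) := by
    ext x
    simp only [Set.mem_setOf_eq, cplxEmb_im, SetLike.mem_coe, LinearMap.mem_ker, hφ]
    have h3 : Real.sqrt 3 / 2 ≠ 0 := by positivity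
    constructor
    · intro h; rcases mul_eq_zero.mp h with h | h
      · exact absurd h h3
      · exact h
    · intro h; rw [h, mul_zero]
  rw [hset]
  haveI := isAddHaarMeasure_volume_coeff
  refine Measure.addHaar_submodule volume _ ?_
  intro htop
  have : ((0 : ℝ), (1 : ℝ), (0 : ℝ)) ∈ LinearMap.ker φ := by rw [htop]; trivial
  rw [LinearMap.mem_ker, hφ] at this
  simp at this
  exact rho_pos.ne' this

/-- `InBox ⊆ genRegion 2 (2E) (−π) π ∪ {Im β′ = 0}` (the angle of `β′` lies in `(−π, π]`, and `= π` forces `Im β′ = 0`).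
[folklore] -/
theorem inBox_subset_genRegion_union (N₁ N₂ M₃ : ℝ) :
    {x | InBox N₁ N₂ M₃ x} ⊆ genRegion 2 (2 * unitE) (-Real.pi) Real.pi N₁ N₂ ∪ {x | (cplxEmb x).im = 0} := by
  intro x hx
  obtain ⟨h1, h2, h3, h4, -⟩ := hx
  by_cases him : (cplxEmb x).im = 0
  · exact Or.inr him
  · left
    refine ⟨h1, h2, h3, h4, ?_⟩
    refine ⟨Complex.neg_pi_lt_arg _, lt_of_le_of_ne (Complex.arg_le_pi _) fun h => him ?_⟩
    exact (Complex.arg_eq_pi_iff.mp h).2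

/-! ### The upper Riemann sum -/

/-- **`∑_{k ∈ goodSet} m³/N⁺_k ≤ ∫_{box} dx/N(x) ≤ genVolume 2 (2E) (−π) π N₁ N₂`** (`0 < N₁ ≤ N₂`, `0 ≤ η ≤ 1/2`, `m > 0`,
`6000 m ≤ ηN₁^{1/3}`). [cite: HeathBrown2001LargestPrimeFactorCubic, §8 p. 33 ("∑_𝓑 I(𝓑) ≤ I(𝓡₀)")] -/
theorem sum_good_cubes_le_genVolume {N₁ N₂ M₃ η m : ℝ} (hN₁ : 0 < N₁) (hN : N₁ ≤ N₂) (hη : 0 < η) (hη1 : η ≤ 1 / 2)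
    (hm : 0 < m) (C2 : 6000 * m ≤ η * N₁ ^ ((1 : ℝ) / 3)) (K : ℕ) :
    ∑ k ∈ goodSet N₁ N₂ M₃ m K, m ^ 3 / NplusRel η m k ≤ genVolume 2 (2 * unitE) (-Real.pi) Real.pi N₁ N₂ := by
  classical
  set G := goodSet N₁ N₂ M₃ m K with hG
  set f : ℝ × ℝ × ℝ → ℝ := fun x => (normForm x)⁻¹ with hf
  have hfmeas : Measurable f := (continuous_normForm.measurable).inv
  -- integrability of `f` on each cube (bounded by `N₁⁻¹`)
  have hgood : ∀ k ∈ G, ∀ y ∈ hCube m k, 0 < NplusRel η m k ∧ normForm y ≤ NplusRel η m k ∧ N₁ < normForm y := by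
    intro k hk y hy
    rw [hG, goodSet, Finset.mem_filter] at hk
    have hy' := hCube_subset_gridCube m k hy
    obtain ⟨hpos, hle, -⟩ := inv_normForm_le_rel hN₁ hN hη hη1 hm C2 hk.2 hy'
    exact ⟨hpos, hle, (hk.2 y hy').1⟩
  have hint : ∀ k ∈ G, IntegrableOn f (hCube m k) := by
    intro k hk
    refine Measure.integrableOn_of_bounded (M := N₁⁻¹) ?_ hfmeas.aestronglyMeasurable ?_
    · rw [volume_hCube hm.le]; exact ENNReal.ofReal_ne_top
    · rw [ae_restrict_iff' (measurableSet_hCube m k)]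
      refine Filter.Eventually.of_forall fun y hy => ?_
      obtain ⟨-, -, hN1y⟩ := hgood k hk y hy
      rw [hf, Real.norm_eq_abs, abs_of_pos (inv_pos.mpr (hN₁.trans hN1y))]
      exact inv_anti₀ hN₁ hN1y.le
  -- Step 1: `m³/N⁺_k ≤ ∫_{hCube k} f`
  have hstep1 : ∀ k ∈ G, m ^ 3 / NplusRel η m k ≤ ∫ y in hCube m k, f y := by
    intro k hk
    have hpos : 0 < NplusRel η m k := by
      obtain ⟨y, hy⟩ : (hCube m k).Nonempty := by
        refine ⟨corner m k + (m, m, m), ?_⟩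
        simp only [hCube, corner, Set.mem_prod, Set.mem_Ioc, Prod.fst_add, Prod.snd_add]
        refine ⟨⟨by linarith, by linarith⟩, ⟨by linarith, by linarith⟩, ⟨by linarith, by linarith⟩⟩
      exact (hgood k hk y hy).1
    calc m ^ 3 / NplusRel η m k = ∫ _y in hCube m k, (NplusRel η m k)⁻¹ := by
          rw [setIntegral_const, measureReal_def, volume_hCube hm.le, ENNReal.toReal_ofReal (by positivity), smul_eq_mul]
          ring
      _ ≤ ∫ y in hCube m k, f y := by
          refine setIntegral_mono_on (integrableOn_const ?_) (hint k hk) (measurableSet_hCube m k) fun y hy => ?_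
          · rw [volume_hCube hm.le]; exact ENNReal.ofReal_ne_top
          · obtain ⟨hp, hle, hN1y⟩ := hgood k hk y hy
            exact inv_anti₀ (hN₁.trans hN1y) hle
  -- Step 2: `∑ ∫_{hCube k} f = ∫_{⋃} f`
  have hdisj : Set.Pairwise (↑G : Set (ℕ × ℕ × ℕ)) (Function.onFun Disjoint (hCube m)) :=
    fun k _ k' _ hkk => disjoint_hCube hm hkk
  have hU := integral_biUnion_finset G (fun k _ => measurableSet_hCube m k) hdisj hint
  -- Step 3: `∫_{⋃} f ≤ genVolume`
  set U : Set (ℝ × ℝ × ℝ) := ⋃ k ∈ G, hCube m k with hUdef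
  have hUmeas : MeasurableSet U := Finset.measurableSet_biUnion G fun k _ => measurableSet_hCube m k
  have hUsub : U ⊆ {x | InBox N₁ N₂ M₃ x} := by
    intro x hx
    rw [hUdef, Set.mem_iUnion₂] at hx
    obtain ⟨k, hk, hxk⟩ := hx
    rw [hG, goodSet, Finset.mem_filter] at hk
    exact hk.2 x (hCube_subset_gridCube m k hxk)
  have hE : 1 < unitE := one_lt_unitE
  have hintU : IntegrableOn f U := by
    rw [hUdef]; exact (integrableOn_finset_iUnion).mpr hint
  have hle_ae : (fun x => U.indicator f x) ≤ᵐ[volume] genIntegrand 2 (2 * unitE) (-Real.pi) Real.pi N₁ N₂ := by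
    have hZ : ∀ᵐ x ∂(volume : Measure (ℝ × ℝ × ℝ)), (cplxEmb x).im ≠ 0 := by
      rw [ae_iff]; simpa using volume_im_zero
    filter_upwards [hZ] with x hx
    by_cases hxU : x ∈ U
    · rw [Set.indicator_of_mem hxU]
      have hreg : x ∈ genRegion 2 (2 * unitE) (-Real.pi) Real.pi N₁ N₂ := by
        rcases inBox_subset_genRegion_union N₁ N₂ M₃ (hUsub hxU) with h | h
        · exact h
        · exact absurd h hx
      rw [genIntegrand, Set.indicator_of_mem hreg]
    · rw [Set.indicator_of_notMem hxU]
      exact genIntegrand_nonneg hN₁.le x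
  calc ∑ k ∈ G, m ^ 3 / NplusRel η m k ≤ ∑ k ∈ G, ∫ y in hCube m k, f y := Finset.sum_le_sum hstep1
    _ = ∫ y in U, f y := by rw [hUdef, hU]
    _ = ∫ y, U.indicator f y := (integral_indicator hUmeas).symm
    _ ≤ ∫ y, genIntegrand 2 (2 * unitE) (-Real.pi) Real.pi N₁ N₂ y :=
        integral_mono_ae ((integrable_indicator_iff hUmeas).mpr hintU)
          (integrable_genIntegrand hN₁ (by norm_num) (by linarith)) hle_ae
    _ = genVolume 2 (2 * unitE) (-Real.pi) Real.pi N₁ N₂ := rfl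

end Literature.NumberTheory.Sieve.HeathBrown2001
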